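import Summits.BirchSwinnertonDyer.BirchSwinnertonDyer.Theorems.PrintX8VSPublishedInputsX8CoreSlimPoitouTateSha
import Summits.BirchSwinnertonDyer.BirchSwinnertonDyer.Theorems.ThetaPartnerAtTwoSignedControlAtTwoStubPoitouTateShaRat
import HarnessLib

set_option linter.dupNamespace false -- `…BirchSwinnertonDyer.BirchSwinnertonDyer…` is the cell's nested layout (D-0017)
set_option autoImplicit false

/-!
# `PrintX8VS`: pack `PublishedInputsX8Core` (item 23004) and bundle `PublishedInputsX8` (item 20403) from their E-SPECIFIC PRINT children
# ONLY — both generic Poitou–Tate rows discharged (LADDER-BSD D-0154 (2), INPUTS-LIST-2 rows 7–8)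

Seat `bsd-inputs-honda-p1` (gen 6, idle INPUTS prover of the desk `pub/bsd-wall/bsd-inputs`), `--supports` stmt-BirchSwinnertonDyer-23004 (also
serves the bundle 20403). THEOREMS ONLY (no definition, no named fact, no `sorry`); pure re-export, no new mathematics.

History of the pack's displayed base (rows 7–8): g0 6 print inputs (pack-p1 T1) → 4 E-specific prints + {PT-Sel, PT-Ш}(ℚ) (T7 p620570) → 4 prints +
PT-Ш(ℚ) (T13b p627151, PT-Sel by bsd-schneider's `poitouTate_selmerStructure_duality_holds`) → **4 prints** (this file): PT-Ш is, since
2026-08-28T11:36Z, a THEOREM for every number field — `SignedEC.PoitouTateShaRat.poitouTate_sha_tateDual_numberField (K)` (bsd-wall K4, k4-p1 g0,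
p629917; item 20462 closed by chl-p2 g7). The four remaining children are E-specific printed inputs: `InputBKOCorA5SharpFlat` (BKO A.5 ♯/♭, 20412),
`InputNewform` (Modularity, 19382), `InputSharpFlatTorsion` (Sprung 2012 Thm. 7.14, 20414), `InputKatoSharpFlatDivisibility` (Thm. 7.16, 20415);
`InputHondaSystem` (Sprung 2012 Thm. 2.2, honda-p1 g0 p618507), `InputLem59AllN` (Sprung 2024 Lemma 5.9, this seat's F16 closer) and
`InputEntireLFunction` (from the newform) are theorems / derived.

Honest framing: CONDITIONAL doors (four printed inputs as hypotheses); 23004 / 20403 are NOT closed; no crux and no summit statement is proved;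
the Birch–Swinnerton-Dyer conjecture is NOT proved by any of this. References: [Sprung2024] §5.2, Lemma 5.9; [Sprung2012] Thms. 2.2, 7.14, 7.16;
[MilneADT2006] Ch. I, Thm. 4.10.
-/

noncomputable section

namespace Summit.BirchSwinnertonDyer.BirchSwinnertonDyer.Theorems

open Literature.NumberTheory.GaloisCohomology Literature.NumberTheory.EllipticCurves
  Summit.BirchSwinnertonDyer.BirchSwinnertonDyer.Theses.PrintX8VS

/-- **Pack `PublishedInputsX8Core` (item 23004) from its FOUR E-specific print children ALONE**: `publishedInputsX8Core_of_slim_poitouTateSha`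
at the tree theorem `SignedEC.PoitouTateShaRat.poitouTate_sha_tateDual_numberField ℚ`. Conditional on the four prints; closes nothing; BSD is
not proved by this. [cite: Sprung2024, §5.2 and Lemma 5.9] [cite: MilneADT2006, Ch. I, Thm. 4.10 (a)] -/
theorem publishedInputsX8Core_of_prints
    (hBKO : InputBKOCorA5SharpFlat) (hmod : InputNewform) (hTors : InputSharpFlatTorsion) (hKato : InputKatoSharpFlatDivisibility) :
    Summit.BirchSwinnertonDyer.BirchSwinnertonDyer.Theses.PrintX8VS.PublishedInputsX8Core :=
  publishedInputsX8Core_of_slim_poitouTateSha hBKO hmod hTors hKato (SignedEC.PoitouTateShaRat.poitouTate_sha_tateDual_numberField ℚ)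

/-- **Bundle `PublishedInputsX8` (item 20403) from the four prints and Mazur's Manin-constant fact** (`ModularForms.mazur_not_dvd_maninConstant_of_odd`):
`publishedInputsX8_of_slim_poitouTateSha` at `…poitouTate_sha_tateDual_numberField ℚ`. Conditional; closes nothing; BSD is not proved by this.
[cite: Sprung2024, §5.2] [cite: MilneADT2006, Ch. I, Thm. 4.10 (a)] -/
theorem publishedInputsX8_of_prints_mazur
    (hBKO : InputBKOCorA5SharpFlat) (hmod : InputNewform) (hTors : InputSharpFlatTorsion) (hKato : InputKatoSharpFlatDivisibility)
    (hMazur : ModularForms.mazur_not_dvd_maninConstant_of_odd) :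
    Summit.BirchSwinnertonDyer.BirchSwinnertonDyer.Theses.PrintX8VS.PublishedInputsX8 :=
  publishedInputsX8_of_slim_poitouTateSha hBKO hmod hTors hKato hMazur (SignedEC.PoitouTateShaRat.poitouTate_sha_tateDual_numberField ℚ)

/-- **Bundle `PublishedInputsX8` (item 20403) from the four prints and the period child `InputPeriodUnitThree`**:
`publishedInputsX8_of_slim_period_poitouTateSha` at `…poitouTate_sha_tateDual_numberField ℚ`. Conditional; closes nothing; BSD is not proved by
this. [cite: Sprung2024, §5.2] [cite: MilneADT2006, Ch. I, Thm. 4.10 (a)] -/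
theorem publishedInputsX8_of_prints_period
    (hBKO : InputBKOCorA5SharpFlat) (hmod : InputNewform) (hTors : InputSharpFlatTorsion) (hKato : InputKatoSharpFlatDivisibility)
    (hPer3 : InputPeriodUnitThree) :
    Summit.BirchSwinnertonDyer.BirchSwinnertonDyer.Theses.PrintX8VS.PublishedInputsX8 :=
  publishedInputsX8_of_slim_period_poitouTateSha hBKO hmod hTors hKato hPer3
    (SignedEC.PoitouTateShaRat.poitouTate_sha_tateDual_numberField ℚ)

end Summit.BirchSwinnertonDyer.BirchSwinnertonDyer.Theorems

end
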